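import Mathlib
import HarnessLib

/-!
# Crux `EulerZoomLiouville.PowerGaugeEulerLiouville` (stmt-NavierStokesRegularity-19832), nsreg-p2 ROUND-56 «THE LOGARITHM'S PRICE», plate t60-RIGID:
# BALL-GAUGE RIGIDITY ABOVE THE ENERGY ENDPOINT (`ρ > ½`)

Seat ns-ezl-w1 g9 (`--supports stmt-NavierStokesRegularity-19832 --as helper`; planner nsreg-p2 g45's ROUND-56 §10 / v1.1 R4 key, 2026-08-29).
VERBATIM port of `r56/Sketch56.lean` (sha16 caee30280605acd0, author nsreg-p2 g45; referee F3d of SCORE-p2-ROUND-55 «the guard made a theorem») §G: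

* `WeakTrace.eq_zero_of_ballGauge_of_half_lt` — if `V : ℝ³ → ℝ³` is continuous and `∫_{B_R}‖V‖² ≤ A·R^{1−2ρ}` for every `R ≥ 1` with `ρ > ½`, then `V = 0`
  (the bound tends to `0` while the left side is non-decreasing in `R`; a continuous function vanishing a.e. on every large ball vanishes).
  Hence every ball-gauge text of the lineage (`WeakTrace.weakTraceLaw_allTests`, `WeakTrace.weakTraceLawLog`, …) speaks beyond rigidity exactly on
  `−2 < ρ ≤ ½` — Seregin's `(0, ½]` included (at `ρ = ½` the gauge is `V ∈ L²(ℝ³)`, not rigidity).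

HONEST FRAMING: an elementary guard statement about HYPOTHETICAL profiles; nothing about the crux E (19832 OPEN) or NS regularity; not E.
-/

noncomputable section

-- flat `Theorems/<Route><Decl>…` files of one crux share the namespace of the crux (tree convention)
set_option linter.dupNamespace false

open MeasureTheory Set Filter Topology Metric Function TopologicalSpace
open scoped ENNReal NNReal RealInnerProductSpace Topology

namespace Summit.NavierStokesRegularity.NavierStokesRegularity.Theorems.PowerGaugeEulerLiouville.WeakTrace

/-- **Ball-gauge rigidity above the energy endpoint.**  If `V` is continuous and `∫_{B_R}‖V‖² ≤ A·R^{1−2ρ}` for every `R ≥ 1` with `ρ > ½`, then `V ≡ 0`: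
the right-hand side tends to `0` as `R → ∞` while the left-hand side is non-decreasing in `R`.  Hence every ball-gauge text of the lineage
(`WeakTraceLawLog`, `PressureBudgetLogLaw`, the landed `WeakTrace.weakTraceLaw_allTests`) speaks beyond rigidity exactly on `−2 < ρ ≤ ½` — Seregin's range `(0, ½]` included. -/
theorem eq_zero_of_ballGauge_of_half_lt {ρ A : ℝ} (hρ : 1 / 2 < ρ) {V : (EuclideanSpace ℝ (Fin 3)) → (EuclideanSpace ℝ (Fin 3))} (hV : Continuous V)
    (hA : ∀ R : ℝ, 1 ≤ R → ∫ y in ball (0 : (EuclideanSpace ℝ (Fin 3))) R, ‖V y‖ ^ 2 ≤ A * R ^ (1 - 2 * ρ)) : V = 0 := by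
  -- Step 1: for every `R₀ ≥ 1`, `∫_{B_{R₀}}‖V‖² ≤ A R^{1−2ρ}` for all `R ≥ R₀`, hence `≤ 0` in the limit.
  have hint : ∀ R : ℝ, IntegrableOn (fun y => ‖V y‖ ^ 2) (ball (0 : (EuclideanSpace ℝ (Fin 3))) R) := fun R =>
    ((hV.norm.pow 2).continuousOn.integrableOn_compact (isCompact_closedBall (0 : (EuclideanSpace ℝ (Fin 3))) R)).mono_set ball_subset_closedBall
  have hmono : ∀ R₀ R : ℝ, R₀ ≤ R → ∫ y in ball (0 : (EuclideanSpace ℝ (Fin 3))) R₀, ‖V y‖ ^ 2 ≤ ∫ y in ball (0 : (EuclideanSpace ℝ (Fin 3))) R, ‖V y‖ ^ 2 :=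
    fun R₀ R h => setIntegral_mono_set (hint R) (ae_of_all _ fun y => by positivity)
      (ae_of_all _ (ball_subset_ball h))
  have hlim : Tendsto (fun R : ℝ => A * R ^ (1 - 2 * ρ)) atTop (𝓝 0) := by
    have h : Tendsto (fun R : ℝ => R ^ (1 - 2 * ρ)) atTop (𝓝 0) := by
      have : 1 - 2 * ρ = -(2 * ρ - 1) := by ring
      rw [this]; exact tendsto_rpow_neg_atTop (by linarith)
    simpa using h.const_mul A
  have hzero : ∀ R₀ : ℝ, 1 ≤ R₀ → ∫ y in ball (0 : (EuclideanSpace ℝ (Fin 3))) R₀, ‖V y‖ ^ 2 = 0 := by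
    intro R₀ hR₀
    have hnn : 0 ≤ ∫ y in ball (0 : (EuclideanSpace ℝ (Fin 3))) R₀, ‖V y‖ ^ 2 := setIntegral_nonneg measurableSet_ball fun y _ => by positivity
    have hle : ∫ y in ball (0 : (EuclideanSpace ℝ (Fin 3))) R₀, ‖V y‖ ^ 2 ≤ 0 := by
      refine ge_of_tendsto hlim ?_
      filter_upwards [eventually_ge_atTop R₀] with R hR
      exact (hmono R₀ R hR).trans (hA R (hR₀.trans hR))
    linarith
  -- Step 2: a continuous non-negative function with zero integral on every large ball vanishes.
  funext x
  obtain ⟨R₀, hR₀1, hxR⟩ : ∃ R₀ : ℝ, 1 ≤ R₀ ∧ x ∈ ball (0 : (EuclideanSpace ℝ (Fin 3))) R₀ :=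
    ⟨max 1 (‖x‖ + 1), le_max_left _ _, by rw [mem_ball_zero_iff]; exact lt_of_lt_of_le (lt_add_one _) (le_max_right _ _)⟩
  have hae := (setIntegral_eq_zero_iff_of_nonneg_ae (ae_of_all _ fun y => by positivity) (hint R₀)).1 (hzero R₀ hR₀1)
  -- `‖V‖² = 0` a.e. on the ball ⇒ `V = 0` a.e. on the ball ⇒ everywhere on the (open) ball by continuity
  have hae' : ∀ᵐ y ∂(volume.restrict (ball (0 : (EuclideanSpace ℝ (Fin 3))) R₀)), V y = 0 := by
    filter_upwards [hae] with y hy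
    have : ‖V y‖ ^ 2 = 0 := by simpa using hy
    simpa using this
  show V x = 0
  by_contra hne
  have hopen : IsOpen (ball (0 : (EuclideanSpace ℝ (Fin 3))) R₀ ∩ {y | V y ≠ 0}) := isOpen_ball.inter (isOpen_ne_fun hV continuous_const)
  have hxmem : x ∈ ball (0 : (EuclideanSpace ℝ (Fin 3))) R₀ ∩ {y | V y ≠ 0} := ⟨hxR, hne⟩
  have hposmeas : 0 < volume (ball (0 : (EuclideanSpace ℝ (Fin 3))) R₀ ∩ {y | V y ≠ 0}) := hopen.measure_pos volume ⟨x, hxmem⟩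
  have hnull : volume (ball (0 : (EuclideanSpace ℝ (Fin 3))) R₀ ∩ {y | V y ≠ 0}) = 0 := by
    have h3 : (volume.restrict (ball (0 : (EuclideanSpace ℝ (Fin 3))) R₀)) {y | V y ≠ 0} = 0 := by
      rw [ae_iff] at hae'; simpa using hae'
    rwa [Measure.restrict_apply' measurableSet_ball, inter_comm] at h3
  exact absurd hnull hposmeas.ne'

end Summit.NavierStokesRegularity.NavierStokesRegularity.Theorems.PowerGaugeEulerLiouville.WeakTrace

end
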